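import Mathlib
import HarnessLib
import Summits.Parity.GeneralizedHardyLittlewood.Theorems.LeeYangFibresAbsoluteUpgradeDefs
import Summits.Parity.GeneralizedHardyLittlewood.Theorems.LeeYangFibresAbsoluteUpgradeWalshClippingAux

/-!
# What the clipping lemma really consumes: flip-invariance of the Walsh form (line `nlc-cells-absolute-clip`)

Crux `AbsoluteUpgrade` (stmt-Parity-14116).  The proof of `stub_walshClipping`
(`Theorems/LeeYangFibresAbsoluteUpgradeWalshClipping.lean`) uses the corner negative-lattice condition only
to derive FLIP-INVARIANCE of the Walsh form, `|Θ(D, +_{i₀}) − Θ(D, −_{i₀})| ≤ κ` for every coordinate `i₀`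
and every sign pattern `D` on the other coordinates; from there on the conclusion is pure Walsh inversion.
This file isolates that second half as a stand-alone statement (registered sub-goal `walshFlip_clipping`):

* `abs_coeff_le_of_flip` : flip-invariance with slack `κ` forces `|θ_S| ≤ κ/2` for every `S ≠ ∅`;
* `walshFlip_clipping`   : hence `|Θ_θ(𝟙) − 1| ≤ 2^t · κ/2`.

For the planner (promote-stub dossier of the line): at the cell level flip-invariance reads
`C_j / m_j ≈ C_{j'} / m_{j'}` whenever the corner indices `j, j'` differ in ONE coordinate `i₀` with
`{j_{i₀}, j'_{i₀}} = {1, 2}` — conditional equidistribution of the `Ω`-parity of `ψ_{i₀}(n)` given the cells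
of the other forms.  Given the cell parity law and the sieve-visible singles, `CellNLC` implies it (steps 1–3
of `stub_walshClipping`) and it implies the clipping conclusion (this file); so it is an admissible, smaller
replacement for the input `CellNLC` (`2t·2^{t−1}` two-sided relations instead of `9^t` one-sided ones), of the
same Hardy–Littlewood strength.

References: Walsh–Fourier analysis on `{±1}^t` (folklore; O'Donnell, *Analysis of Boolean Functions*, Ch. 1).
-/

noncomputable section

open scoped BigOperators Classical
open Finset

namespace Summit.Parity.GeneralizedHardyLittlewood.Theorems.AbsoluteUpgrade

open Summit.Parity.GeneralizedHardyLittlewood.Cruxes.AbsoluteUpgrade.NlcCellsAbsoluteClip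
open WalshClip

/-- **Flip-invariance bounds every non-constant Walsh coefficient.** If
`|Θ(D,+_{i₀}) − Θ(D,−_{i₀})| ≤ κ` for all `i₀` and all `D ⊆ [t] ∖ {i₀}`, then `|θ_S| ≤ κ/2` for every
`S ≠ ∅` (Walsh inversion in the coordinates of `[t] ∖ {i₀}`, `i₀ ∈ S`). [folklore] -/
theorem abs_coeff_le_of_flip {t : ℕ} (θ : Finset (Fin t) → ℝ) (κ : ℝ)
    (hflip : ∀ (i₀ : Fin t) (D : Finset (Fin t)), i₀ ∉ D →
      |wEval θ (pat i₀ D 1) - wEval θ (pat i₀ D (-1))| ≤ κ)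
    (S : Finset (Fin t)) (hS : S ≠ ∅) : |θ S| ≤ κ / 2 := by
  obtain ⟨i₀, h₀⟩ := Finset.nonempty_iff_ne_empty.mpr hS
  set U : Finset (Fin t) := Finset.univ.erase i₀ with hU
  have hU0 : (0 : ℝ) < (2 : ℝ) ^ U.card := by positivity
  have hDU : ∀ D ∈ U.powerset, i₀ ∉ D := fun D hD h =>
    (Finset.notMem_erase i₀ Finset.univ) (Finset.mem_powerset.mp hD h)
  have hinv := walshInversion θ h₀
  have hbound : |∑ D ∈ U.powerset,
      (∏ i ∈ D, ySign S i) * (wEval θ (pat i₀ D 1) - wEval θ (pat i₀ D (-1)))| ≤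
      (2 : ℝ) ^ U.card * κ := by
    calc _ ≤ ∑ D ∈ U.powerset,
          |(∏ i ∈ D, ySign S i) * (wEval θ (pat i₀ D 1) - wEval θ (pat i₀ D (-1)))| :=
          Finset.abs_sum_le_sum_abs _ _
      _ ≤ ∑ _D ∈ U.powerset, κ := Finset.sum_le_sum fun D hD => by
          rw [abs_mul, prod_ySign, abs_neg_one_pow, one_mul]
          exact hflip i₀ D (hDU D hD)
      _ = (2 : ℝ) ^ U.card * κ := by
          rw [Finset.sum_const, nsmul_eq_mul, Finset.card_powerset]; push_cast; ring
  rw [hinv] at hbound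
  have h2 : 2 * (2 : ℝ) ^ U.card * θ S = (2 : ℝ) ^ U.card * (2 * θ S) := by ring
  rw [h2, abs_mul, abs_of_pos hU0] at hbound
  have h3 : |2 * θ S| ≤ κ := le_of_mul_le_mul_left hbound hU0
  rw [abs_mul, abs_two] at h3
  linarith

/-- **Flip-invariance clips the prime corner** (registered sub-goal of the line; the NLC-free half of
`stub_walshClipping`): with `θ_∅ = 1`, flip-invariance with slack `κ` gives `|Θ_θ(𝟙) − 1| ≤ 2^t · κ/2`.
[folklore] -/
theorem walshFlip_clipping : ∀ {t : ℕ} (θ : Finset (Fin t) → ℝ) (κ : ℝ), 0 ≤ κ → θ ∅ = 1 → (∀ (i₀ : Fin t) (D : Finset (Fin t)), i₀ ∉ D → |wEval θ (pat i₀ D 1) - wEval θ (pat i₀ D (-1))| ≤ κ) → |walshForm θ (fun _ => 1) - 1| ≤ 2 ^ t * (κ / 2) := by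
  intro t θ κ hκ hθ0 hflip
  have hone : walshForm θ (fun _ => 1) = ∑ S : Finset (Fin t), θ S := by
    unfold walshForm
    refine Finset.sum_congr rfl fun S _ => ?_
    rw [Finset.prod_eq_one fun i _ => by norm_num, mul_one]
  have hsplit : ∑ S : Finset (Fin t), θ S = θ ∅ + ∑ S ∈ Finset.univ.erase ∅, θ S :=
    (Finset.add_sum_erase _ _ (Finset.mem_univ _)).symm
  rw [hone, hsplit, hθ0, add_sub_cancel_left]
  have hcard : ((Finset.univ.erase (∅ : Finset (Fin t))).card : ℝ) ≤ 2 ^ t := by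
    have h := Finset.card_erase_le (s := (Finset.univ : Finset (Finset (Fin t)))) (a := ∅)
    rw [Finset.card_univ, Fintype.card_finset, Fintype.card_fin] at h
    exact_mod_cast h
  calc |∑ S ∈ Finset.univ.erase ∅, θ S|
      ≤ ∑ S ∈ Finset.univ.erase ∅, |θ S| := Finset.abs_sum_le_sum_abs _ _
    _ ≤ ∑ _S ∈ Finset.univ.erase (∅ : Finset (Fin t)), κ / 2 :=
        Finset.sum_le_sum fun S hS => abs_coeff_le_of_flip θ κ hflip S (Finset.ne_of_mem_erase hS)
    _ = ((Finset.univ.erase (∅ : Finset (Fin t))).card : ℝ) * (κ / 2) := by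
        rw [Finset.sum_const, nsmul_eq_mul]
    _ ≤ 2 ^ t * (κ / 2) := by gcongr

end Summit.Parity.GeneralizedHardyLittlewood.Theorems.AbsoluteUpgrade

end
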